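import Summits.QuantumFields.BalabanUV.Beta.ResolventFinLeafRecord
import Summits.QuantumFields.BalabanUV.Beta.ResolventTaylorCoefficients

/-!
# Beta / ResolventFinCoefficients — THE FIN LEAF IN COEFFICIENT CURRENCY: the order-m Taylor family ALONG A FIN is a matrix polynomial in the two
# rectangle displacements `(τ − τ₀, x − x₀)` with explicit coefficients, so the fin residual of a polynomial preconditioner is an explicit polynomial
# and `fin_certificate_taylor`'s two sups follow from finite coefficient-norm sums (β sub-cell, BINDER-OWNERS row CAP-k, lineage
# `b2b-balaban-beta-an5`, gen 27; node BETA-an5-g27-COEFF, leaf 6 — the fin twin of leaf 1 `ResolventTaylorCoefficients`)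

WHY.  After leaves 1∕2∕4 every BOX leaf of engine D's route is sup-free in the kernel; the FIN leaves ((W) by fins, `CapRouteAFins` ∕
`ResolventFinLeafRecord.FinLeafRecord` p229652) still take `hE : ‖1 − P(τ,x)·taylorFamilyFin …‖ ≤ ε` and `hP : ‖P(τ,x)‖ ≤ p` as sups over the rectangle.
The fin increment `finIncr = (τ − τ₀)·(−r_R) + (x − x₀)·(i R_i)` is LINEAR in the two real displacements, so the multinomial step of leaf 1 (at
`d = 1`: `sum_pow_div_factorial` over `Fin 2`) makes `taylorFamilyFin m` the `polyEval` of explicit `finTaylorCoeff`s in `δ = ![τ − τ₀, x − x₀]`, and the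
leaf-1 product∕residual identities apply verbatim:
* §1 `finDisp`, `finSlope`, `finIncr_eq_sum`, `charTaylorFin_eq_sum_degLT`, **`finTaylorCoeff`**, **`taylorFamilyFin_eq_polyEval`**.
* §2 **`finResidualCoeff`**, **`one_sub_polyEval_mul_taylorFamilyFin`**, `abs_finDisp_le` (the rectangle is the `d = 1` box `|δ_μ| ≤ ![hτ, hx]_μ`).
* §3 **`fin_certificate_taylor_ofCoeffs`** — the order-m fin leaf with `hE := Σ_γ ![hτ,hx]^γ ‖finResidualCoeff γ‖ ≤ ε`, `hP := Σ_β ![hτ,hx]^β ‖Z_β‖ ≤ p`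
  (NO sup over the rectangle), and **`FinLeafRecord.certifies_ofCoeffs`** (the admitted fin record p229652 reused: its `ε`, `p` now MEAN the two
  coefficient-norm sums; `Valid` unchanged).

HONEST FRAMING.  Kernel glue ([folklore]); no coefficient, no rectangle, no number supplied; 0 binders of the real row instantiated; 0 certified
coefficients; the fins are ≈ 0 of route A₂'s price (cap3 J29) — this is completeness of the sup-free currency, not a cost item; discharging `BetaPertH`
would make Bałaban's ultraviolet stability UNCONDITIONAL — NOT the continuum limit, NOT the Clay problem.  HONEST DEPENDENCY: continuum YM on T⁴ ⇐
BetaPertH ∧ nine spine estimates (0∕9 proved); BetaPertH ⇐ (D1) ∧ (D4) ∧ CAP+tail; G-an2-4 gates asym, D1 and NE2∕3∕4.  0 `sorry`, 0 cite tags.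
-/

namespace Summit.QuantumFields.BalabanUV.Beta.ResolventFinCertificate

open Complex Set Matrix Finset
open Summit.QuantumFields.BalabanUV.Beta.PolyRegularAlgebra (character)
open Summit.QuantumFields.BalabanUV.Beta.ResolventBoxCertificate
open scoped Real Matrix.Norms.L2Operator Pointwise

noncomputable section

variable {d : ℕ} {n : Type*} [Fintype n] [DecidableEq n]

/-! ## §1 The fin Taylor family is a polynomial family in the two rectangle displacements -/

omit [Fintype n] [DecidableEq n] in
/-- the two REAL RECTANGLE DISPLACEMENTS `δ = (τ − τ₀, x − x₀)` as a `Fin (1+1)`-vector. [folklore] -/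
def finDisp (τ₀ x₀ τ x : ℝ) : Fin (1 + 1) → ℝ := ![τ - τ₀, x - x₀]

omit [Fintype n] [DecidableEq n] in
/-- the two COMPLEX SLOPES of the fin increment of the frequency `R`: `(−r_R, i·R_i)`. [folklore] -/
def finSlope (R : Fin (d + 1) → ℤ) (i : Fin (d + 1)) (σ : ℝ) (c : Fin d → ℝ) : Fin (1 + 1) → ℂ :=
  ![-((finRate R i σ c : ℝ) : ℂ), I * (R i : ℂ)]

omit [Fintype n] [DecidableEq n] in
/-- the fin increment is LINEAR in the displacements: `finIncr = Σ_μ δ_μ · finSlope_μ`. [folklore] -/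
theorem finIncr_eq_sum (R : Fin (d + 1) → ℤ) (i : Fin (d + 1)) (σ : ℝ) (c : Fin d → ℝ) (τ₀ x₀ τ x : ℝ) :
    finIncr R i σ c τ₀ x₀ τ x = ∑ μ, ((finDisp τ₀ x₀ τ x μ : ℝ) : ℂ) * finSlope R i σ c μ := by
  simp only [finIncr, finDisp, finSlope, Fin.sum_univ_succ, Fin.sum_univ_zero, Matrix.cons_val_zero, Matrix.cons_val_succ, add_zero]
  push_cast
  ring

omit [Fintype n] [DecidableEq n] in
/-- the fin multi-index weight `Π_μ finSlope_μ^{κ_μ} ∕ κ_μ!`. [folklore] -/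
def finWeight (R : Fin (d + 1) → ℤ) (i : Fin (d + 1)) (σ : ℝ) (c : Fin d → ℝ) (κ : Fin (1 + 1) → ℕ) : ℂ :=
  ∏ μ, finSlope R i σ c μ ^ κ μ / ((κ μ).factorial : ℂ)

omit [Fintype n] [DecidableEq n] in
/-- one Taylor term along the fin: `finIncr^k ∕ k! = Σ_{|κ|=k} δ^κ · finWeight κ`. [folklore] -/
theorem pow_finIncr_div_factorial (R : Fin (d + 1) → ℤ) (i : Fin (d + 1)) (σ : ℝ) (c : Fin d → ℝ) (τ₀ x₀ τ x : ℝ) (k : ℕ) :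
    finIncr R i σ c τ₀ x₀ τ x ^ k / (k.factorial : ℂ)
      = ∑ κ ∈ (univ : Finset (Fin (1 + 1))).piAntidiag k, ((monomial κ (finDisp τ₀ x₀ τ x) : ℝ) : ℂ) * finWeight R i σ c κ := by
  rw [finIncr_eq_sum, sum_pow_div_factorial]
  refine Finset.sum_congr rfl fun κ _ => ?_
  rw [ofReal_monomial, finWeight, ← Finset.prod_mul_distrib]
  exact Finset.prod_congr rfl fun μ _ => by rw [mul_pow]; ring

omit [Fintype n] [DecidableEq n] in
/-- **ONE CHARACTER'S FIN TAYLOR POLYNOMIAL IN MULTI-INDEX FORM**: `charTaylorFin m … τ x = Σ_{κ ∈ degLT 1 m} δ^κ · (χ_R(p₀) · finWeight κ)`. [folklore] -/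
theorem charTaylorFin_eq_sum_degLT (m : ℕ) (R : Fin (d + 1) → ℤ) (i : Fin (d + 1)) (σ : ℝ) (c : Fin d → ℝ) (τ₀ x₀ τ x : ℝ) :
    charTaylorFin m R i σ c τ₀ x₀ τ x
      = ∑ κ ∈ degLT 1 m, ((monomial κ (finDisp τ₀ x₀ τ x) : ℝ) : ℂ) *
          (character R (i.insertNth ((x₀ : ℂ) + ((τ₀ * σ : ℝ) : ℂ) * I) fun j => ((τ₀ * c j : ℝ) : ℂ) * I) * finWeight R i σ c κ) := by
  rw [charTaylorFin, degLT, Finset.sum_biUnion (pairwiseDisjoint_piAntidiag _), Finset.mul_sum]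
  refine Finset.sum_congr rfl fun k _ => ?_
  rw [pow_finIncr_div_factorial, Finset.mul_sum]
  exact Finset.sum_congr rfl fun κ _ => by ring

/-- **THE FIN TAYLOR COEFFICIENT** of multi-index `κ`: `Σ_{R∈S} χ_R(p(τ₀,x₀)) · finWeight R κ · K[R]` — an EXPLICIT matrix from the tables. [folklore] -/
def finTaylorCoeff (S : Finset (Fin (d + 1) → ℤ)) (K : (Fin (d + 1) → ℤ) → Matrix n n ℂ) (i : Fin (d + 1)) (σ : ℝ) (c : Fin d → ℝ)
    (τ₀ x₀ : ℝ) (κ : Fin (1 + 1) → ℕ) : Matrix n n ℂ :=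
  ∑ R ∈ S, (character R (i.insertNth ((x₀ : ℂ) + ((τ₀ * σ : ℝ) : ℂ) * I) fun j => ((τ₀ * c j : ℝ) : ℂ) * I) * finWeight R i σ c κ) • K R

omit [Fintype n] [DecidableEq n] in
/-- **THE FIN TAYLOR FAMILY IS A POLYNOMIAL FAMILY IN THE RECTANGLE DISPLACEMENTS**:
`taylorFamilyFin m S K i σ c τ₀ x₀ τ x = polyEval (degLT 1 m) (finTaylorCoeff S K i σ c τ₀ x₀) (finDisp τ₀ x₀ τ x)`. [folklore] -/
theorem taylorFamilyFin_eq_polyEval (m : ℕ) (S : Finset (Fin (d + 1) → ℤ)) (K : (Fin (d + 1) → ℤ) → Matrix n n ℂ) (i : Fin (d + 1))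
    (σ : ℝ) (c : Fin d → ℝ) (τ₀ x₀ τ x : ℝ) :
    taylorFamilyFin m S K i σ c τ₀ x₀ τ x = polyEval (degLT 1 m) (finTaylorCoeff S K i σ c τ₀ x₀) (finDisp τ₀ x₀ τ x) := by
  simp only [taylorFamilyFin, charTaylorFin_eq_sum_degLT, Finset.sum_smul, polyEval, finTaylorCoeff, Finset.smul_sum, smul_smul]
  rw [Finset.sum_comm]

/-! ## §2 The fin residual of a polynomial preconditioner is an explicit polynomial family -/

variable [DecidableEq (Fin (1 + 1) → ℕ)]

/-- **THE FIN RESIDUAL COEFFICIENTS**: `finResidualCoeff γ = [γ = 0]·1 − Σ_{β+κ=γ} Z_β · finTaylorCoeff κ`. [folklore] -/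
def finResidualCoeff (T_P : Finset (Fin (1 + 1) → ℕ)) (Z : (Fin (1 + 1) → ℕ) → Matrix n n ℂ) (m : ℕ) (S : Finset (Fin (d + 1) → ℤ))
    (K : (Fin (d + 1) → ℤ) → Matrix n n ℂ) (i : Fin (d + 1)) (σ : ℝ) (c : Fin d → ℝ) (τ₀ x₀ : ℝ) (γ : Fin (1 + 1) → ℕ) : Matrix n n ℂ :=
  (if γ = 0 then 1 else 0) - convCoeff T_P (degLT 1 m) Z (finTaylorCoeff S K i σ c τ₀ x₀) γ

/-- **THE FIN RESIDUAL OF A POLYNOMIAL PRECONDITIONER IS AN EXPLICIT POLYNOMIAL FAMILY**: with `P(τ,x) = polyEval T_P Z (finDisp τ₀ x₀ τ x)`,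
`1 − P(τ,x)·taylorFamilyFin m … τ x = polyEval (insert 0 (T_P + degLT 1 m)) finResidualCoeff (finDisp τ₀ x₀ τ x)`. [folklore] -/
theorem one_sub_polyEval_mul_taylorFamilyFin (T_P : Finset (Fin (1 + 1) → ℕ)) (Z : (Fin (1 + 1) → ℕ) → Matrix n n ℂ) (m : ℕ)
    (S : Finset (Fin (d + 1) → ℤ)) (K : (Fin (d + 1) → ℤ) → Matrix n n ℂ) (i : Fin (d + 1)) (σ : ℝ) (c : Fin d → ℝ) (τ₀ x₀ τ x : ℝ) :
    1 - polyEval T_P Z (finDisp τ₀ x₀ τ x) * taylorFamilyFin m S K i σ c τ₀ x₀ τ x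
      = polyEval (insert 0 (T_P + degLT 1 m)) (finResidualCoeff T_P Z m S K i σ c τ₀ x₀) (finDisp τ₀ x₀ τ x) := by
  rw [taylorFamilyFin_eq_polyEval, polyEval_mul_polyEval]
  set δ := finDisp τ₀ x₀ τ x
  set Γ := T_P + degLT 1 m
  have h1 : ∑ γ ∈ insert 0 Γ, ((monomial γ δ : ℝ) : ℂ) • (if γ = 0 then (1 : Matrix n n ℂ) else 0) = 1 := by
    have e : ∀ γ ∈ insert 0 Γ, ((monomial γ δ : ℝ) : ℂ) • (if γ = 0 then (1 : Matrix n n ℂ) else 0)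
        = if γ = 0 then ((monomial γ δ : ℝ) : ℂ) • (1 : Matrix n n ℂ) else 0 := fun γ _ => by
      split_ifs <;> simp
    rw [Finset.sum_congr rfl e, Finset.sum_ite_eq' (insert 0 Γ) 0, if_pos (Finset.mem_insert_self _ _), monomial_zero]
    simp
  have h2 : ∑ γ ∈ insert 0 Γ, ((monomial γ δ : ℝ) : ℂ) • convCoeff T_P (degLT 1 m) Z (finTaylorCoeff S K i σ c τ₀ x₀) γ
      = polyEval Γ (convCoeff T_P (degLT 1 m) Z (finTaylorCoeff S K i σ c τ₀ x₀)) δ := by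
    rw [polyEval]
    refine Finset.sum_insert_of_eq_zero_if_notMem fun h0 => ?_
    rw [convCoeff_eq_zero_of_not_mem _ _ h0, smul_zero]
  symm
  calc polyEval (insert 0 Γ) (finResidualCoeff T_P Z m S K i σ c τ₀ x₀) δ
      = ∑ γ ∈ insert 0 Γ, (((monomial γ δ : ℝ) : ℂ) • (if γ = 0 then (1 : Matrix n n ℂ) else 0)
          - ((monomial γ δ : ℝ) : ℂ) • convCoeff T_P (degLT 1 m) Z (finTaylorCoeff S K i σ c τ₀ x₀) γ) :=
        Finset.sum_congr rfl fun γ _ => by rw [finResidualCoeff, smul_sub]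
    _ = 1 - polyEval Γ (convCoeff T_P (degLT 1 m) Z (finTaylorCoeff S K i σ c τ₀ x₀)) δ := by rw [Finset.sum_sub_distrib, h1, h2]

omit [Fintype n] [DecidableEq n] [DecidableEq (Fin (1 + 1) → ℕ)] in
/-- the rectangle IS the `d = 1` box: `|δ_μ| ≤ ![hτ, hx]_μ`. [folklore] -/
theorem abs_finDisp_le {τ₀ x₀ τ x hτ hx : ℝ} (hτ' : |τ - τ₀| ≤ hτ) (hx' : |x - x₀| ≤ hx) :
    ∀ μ, |finDisp τ₀ x₀ τ x μ| ≤ (![hτ, hx] : Fin (1 + 1) → ℝ) μ := by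
  intro μ
  fin_cases μ
  · simpa [finDisp] using hτ'
  · simpa [finDisp] using hx'

/-! ## §3 The order-m fin leaf in COEFFICIENT CURRENCY -/

/-- **THE ORDER-m FIN CERTIFICATE IN COEFFICIENT CURRENCY** (one rectangle; the SUP STEP is the kernel's).  ENGINE DATA: the coefficient matrices
`Z_β` (`β ∈ T_P`, multi-indices over the two displacements) of a polynomial preconditioner and two numbers — `ε ≥ Σ_{γ ∈ insert 0 (T_P + degLT 1 m)}
![hτ,hx]^γ ‖finResidualCoeff γ‖`, `p ≥ Σ_{β ∈ T_P} ![hτ,hx]^β ‖Z_β‖`; KERNEL: the tail `taylorTailFin`; CHECKS: `ε + p·taylorTailFin ≤ θ < 1`.  THEN at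
every fin point of the rectangle `A(p)` is invertible with `‖A(p)⁻¹‖ ≤ p∕(1−θ)`, `A q = Σ_{R∈S} χ_q(R) K[R]`. [folklore] -/
theorem fin_certificate_taylor_ofCoeffs {m : ℕ} (hm : 0 < m) (S : Finset (Fin (d + 1) → ℤ)) (K : (Fin (d + 1) → ℤ) → Matrix n n ℂ)
    (i : Fin (d + 1)) (σ : ℝ) (c : Fin d → ℝ) {τ₀ x₀ hτ hx : ℝ}
    (hsmall : ∀ R ∈ S, |finRate R i σ c| * hτ + |(R i : ℝ)| * hx ≤ 1)
    (T_P : Finset (Fin (1 + 1) → ℕ)) (Z : (Fin (1 + 1) → ℕ) → Matrix n n ℂ) {ε p θ : ℝ}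
    (hE : ∑ γ ∈ insert 0 (T_P + degLT 1 m), monomial γ (![hτ, hx] : Fin (1 + 1) → ℝ) *
      ‖finResidualCoeff T_P Z m S K i σ c τ₀ x₀ γ‖ ≤ ε)
    (hP : ∑ β ∈ T_P, monomial β (![hτ, hx] : Fin (1 + 1) → ℝ) * ‖Z β‖ ≤ p)
    (hθ : ε + p * taylorTailFin m S K i σ c τ₀ hτ hx ≤ θ) (hθ1 : θ < 1) :
    ∀ τ x : ℝ, |τ - τ₀| ≤ hτ → |x - x₀| ≤ hx →
      IsUnit (∑ R ∈ S, character R (i.insertNth ((x : ℂ) + ((τ * σ : ℝ) : ℂ) * I) fun j => ((τ * c j : ℝ) : ℂ) * I) • K R).det ∧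
        ‖(∑ R ∈ S, character R (i.insertNth ((x : ℂ) + ((τ * σ : ℝ) : ℂ) * I) fun j => ((τ * c j : ℝ) : ℂ) * I) • K R)⁻¹‖
          ≤ p / (1 - θ) := by
  intro τ x hτ' hx'
  have hh : ∀ μ, 0 ≤ (![hτ, hx] : Fin (1 + 1) → ℝ) μ := fun μ => (abs_nonneg _).trans (abs_finDisp_le hτ' hx' μ)
  have hp : 0 ≤ p := (coeffNormSum_nonneg T_P Z hh).trans hP
  refine fin_certificate_taylor hm S K i σ c hsmall (P := fun τ x => polyEval T_P Z (finDisp τ₀ x₀ τ x))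
    (fun τ' x' hτ'' hx'' => ?_) (fun τ' x' hτ'' hx'' => ?_) hp hθ hθ1 τ x hτ' hx'
  · rw [one_sub_polyEval_mul_taylorFamilyFin]
    exact (norm_polyEval_le _ _ (abs_finDisp_le hτ'' hx'')).trans hE
  · exact (norm_polyEval_le _ _ (abs_finDisp_le hτ'' hx'')).trans hP

end

end Summit.QuantumFields.BalabanUV.Beta.ResolventFinCertificate

/-! ## §4 The admitted fin record (p229652) in coefficient currency -/

namespace Summit.QuantumFields.BalabanUV.Beta.ResolventFinLeafRecord

open Complex Set Matrix Finset
open Summit.QuantumFields.BalabanUV.Beta.PolyRegularAlgebra (character)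
open Summit.QuantumFields.BalabanUV.Beta.ResolventBoxCertificate
open Summit.QuantumFields.BalabanUV.Beta.ResolventFinCertificate
open scoped Real Matrix.Norms.L2Operator Pointwise

noncomputable section

variable {d : ℕ} {n : Type*} [Fintype n] [DecidableEq n] [DecidableEq (Fin (1 + 1) → ℕ)]

/-- **A VALID FIN RECORD CERTIFIES ITS RECTANGLE FROM COEFFICIENT DATA**: validity (`0 < m ∧ 0 ≤ p ∧ ε + p·T ≤ θ ∧ θ < 1`) + the coefficient
matrices `Z_β` of a polynomial preconditioner in the two displacements + `Σ ![hτ,hx]^γ ‖finResidualCoeff γ‖ ≤ ε`, `Σ ![hτ,hx]^β ‖Z_β‖ ≤ p` + the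
tail bound `taylorTailFin ≤ T` ⟹ at every fin point of the rectangle the stencil family is invertible with `‖A(p)⁻¹‖ ≤ p∕(1−θ)` — the record's two
«sups» DISCHARGED from finite coefficient-norm sums. [folklore] -/
theorem FinLeafRecord.certifies_ofCoeffs (r : FinLeafRecord) (hv : r.Valid) (S : Finset (Fin (d + 1) → ℤ))
    (K : (Fin (d + 1) → ℤ) → Matrix n n ℂ) (i : Fin (d + 1)) (σ : ℝ) (c : Fin d → ℝ) {τ₀ x₀ hτ hx : ℝ}
    (hsmall : ∀ R ∈ S, |finRate R i σ c| * hτ + |(R i : ℝ)| * hx ≤ 1)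
    (T_P : Finset (Fin (1 + 1) → ℕ)) (Z : (Fin (1 + 1) → ℕ) → Matrix n n ℂ)
    (hE : ∑ γ ∈ insert 0 (T_P + degLT 1 r.m), monomial γ (![hτ, hx] : Fin (1 + 1) → ℝ) *
      ‖finResidualCoeff T_P Z r.m S K i σ c τ₀ x₀ γ‖ ≤ r.ε)
    (hP : ∑ β ∈ T_P, monomial β (![hτ, hx] : Fin (1 + 1) → ℝ) * ‖Z β‖ ≤ r.p)
    (hT : taylorTailFin r.m S K i σ c τ₀ hτ hx ≤ r.T) :
    ∀ τ x : ℝ, |τ - τ₀| ≤ hτ → |x - x₀| ≤ hx →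
      IsUnit (∑ R ∈ S, character R (i.insertNth ((x : ℂ) + ((τ * σ : ℝ) : ℂ) * I) fun j => ((τ * c j : ℝ) : ℂ) * I) • K R).det ∧
        ‖(∑ R ∈ S, character R (i.insertNth ((x : ℂ) + ((τ * σ : ℝ) : ℂ) * I) fun j => ((τ * c j : ℝ) : ℂ) * I) • K R)⁻¹‖
          ≤ (r.p : ℝ) / (1 - r.θ) := by
  obtain ⟨hm, hp0, hθ, hθ1⟩ := hv
  have hθ1' : (r.θ : ℝ) < 1 := by exact_mod_cast hθ1
  have hp0' : (0 : ℝ) ≤ r.p := by exact_mod_cast hp0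
  have hθ' : (r.ε : ℝ) + r.p * taylorTailFin r.m S K i σ c τ₀ hτ hx ≤ r.θ := by
    have h1 : (r.ε : ℝ) + r.p * r.T ≤ r.θ := by exact_mod_cast hθ
    exact (add_le_add le_rfl (mul_le_mul_of_nonneg_left hT hp0')).trans h1
  exact fin_certificate_taylor_ofCoeffs hm S K i σ c hsmall T_P Z hE hP hθ' hθ1'

end

end Summit.QuantumFields.BalabanUV.Beta.ResolventFinLeafRecord
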